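import Summits.QuantumFields.BalabanUV.Beta.GAN24.TaylorMassVHPush

/-!
# `BalabanUV.Beta.GAN24.TaylorMassVHCol` — binder row G-an2-4 / (CONV-C), S-slot, road «S3-Taylor»: generic leaf **VH1**, part 3 — the COLUMN MASSES
# the row assembler `GAN24/TaylorSandwich.sandwich_bound` asks for (row owner gan24-p1-g4 RULINGS-7, journal l.4732: «for fixed multiplier site `y`, the sum
# over the field site `w` AND the stencil index `u`»): for an2's border increment and its push, at a FIXED multiplier site, summed over the background bond
# `u` and the field leg over ANY finite sets — `≤ (4R_V·M+1)^{2(d+1)} · (M·3ℓ²∕M^{d+1})` (level `M`), and `× #LegIdx d L = L^{d+2}` after the push by `L`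
# (the new coarse column collects the `L^{d+1}·L` old contour columns).  Powers of `M`, `L` DISPLAYED, nothing claimed small.

Engine of the idle leaf seat `b2b-balaban-gan24-formalise-leaf-11` (gen 14).  NOT IN PRINT; OUR BOOKKEEPING.  HONEST FRAMING (cell contract, verbatim):
«discharging `BetaPertH` makes Bałaban's UV stability UNCONDITIONAL — a real constructive-QFT result; it is NOT the continuum limit and NOT the Clay problem.»
HONEST DEPENDENCY (verbatim): «continuum YM on T⁴ ⇐ BetaPertH ∧ nine spine estimates (0/9 proved); BetaPertH ⇐ (D1) ∧ (D4) ∧ CAP+tail; G-an2-4 gates asym,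
D1 and NE2/3/4.»  [folklore] corollaries of `GAN24/TaylorMassVH` (support + pointwise size of `borderInc`) and `GAN24/TaylorMassLam.sum_abs_le_of_support`
(box counts); cites nothing, mints no `def … : Prop`, DISCHARGES NOTHING of rows V0∕Vt∕V, «E3Shape»∕«E3SupRate», (hS, hSall), BetaPertH.  NOT continuum, NOT Clay.

## What is proved ([folklore], `0 sorry`)
`card_LegIdx` (`#LegIdx d L = L^{d+1}·L`); **`sum_sum_abs_borderInc_col_inl_inr_le`** (fixed multiplier site `y`: `Σ_{u∈U} Σ_{w∈S} |borderInc d Lc M κ u w y (inl α) (inr μ)|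
≤ (2·(2R_V M)+1)^{2(d+1)} · (M·3ℓ²∕M^{d+1})`), its mirror **`sum_sum_abs_borderInc_col_inr_inl_le`** (fixed multiplier site `x` on the first leg), and the pushed
columns **`sum_sum_abs_pushSum_borderInc_col_inl_inr_le`** ∕ **`…_inr_inl_le`** (`≤ #LegIdx d L ·` the level-`M` column bound, at every site `y`; off the new
coarse lattice the column is `0`).
-/

noncomputable section

open Finset
open scoped BigOperators
open Literature.MathematicalPhysics.QuantumFieldTheory
open Literature.MathematicalPhysics.QuantumFieldTheory.Balaban1983to89
open Literature.MathematicalPhysics.QuantumFieldTheory.Balaban1983to89.Beta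
open Literature.Probability.LatticeModels (Torus.proj)
open LatticeForm (quo)
open B12Sec2to5 (l1 l1_nonneg)
open ExpKernelCalculus (MKer l1_sub_triangle l1_sub_symm)
open OneStepResolventKernel (Fib eq_zsmul_quo_of_proj)
open OneStepKernelFamily (LegIdx legPt)
open AveragingHessianKernels (ell)
open BalabanCompositeJets (pushSum borderInc)
open Summit.QuantumFields.BalabanUV.Beta.GAN24.PushSumNest (pushSum_inr_of_proj_ne pushSum_inr_of_proj_ne')
open Summit.QuantumFields.BalabanUV.Beta.GAN24.TaylorMassLam (sum_abs_le_of_support)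
open Summit.QuantumFields.BalabanUV.Beta.GAN24.TaylorMassVH (abs_borderInc_le borderInc_ne_zero)
open Summit.QuantumFields.BalabanUV.Beta.GAN24.TaylorMassVHPush (pushSum_inl_inr_coarse_sum pushSum_inr_inl_coarse_sum)

namespace Summit.QuantumFields.BalabanUV.Beta.GAN24.TaylorMassVHCol

variable {d : ℕ}

/-- [folklore] The number of contour indices of an `L`-block: `#LegIdx d L = L^{d+1}·L`. -/
theorem card_LegIdx (L : ℕ) : (LegIdx d L).card = L ^ (d + 1) * L := by
  simp only [LegIdx, Finset.card_product, Fintype.card_piFinset, Finset.card_range, Finset.prod_const, Finset.card_univ, Fintype.card_fin]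

section Col

variable {Lc : ℕ} (M : ℕ) [NeZero M]

/-- [folklore] **COLUMN MASS OF THE BORDER INCREMENT, (field, multiplier) block**: at a FIXED multiplier site `y`, summing over the background bond `u ∈ U` and
the field site `w ∈ S` (any finite sets), `Σ_u Σ_w |borderInc d Lc M κ u w y (inl α) (inr μ)| ≤ (2(2R_V M)+1)^{2(d+1)} · (M·3ℓ²∕M^{d+1})`, `R_V = 2(d+1)(Lc+1)+2d+3`
(both `u` and `w` lie within `2R_V·M` of `y`; pointwise size from `TaylorMassVH.abs_borderInc_le`). -/
theorem sum_sum_abs_borderInc_col_inl_inr_le (hL : 1 ≤ Lc) (κ : Fin (d + 1)) (y : Fin (d + 1) → ℤ) (α μ : Fin (d + 1))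
    (U S : Finset (Fin (d + 1) → ℤ)) :
    ∑ u ∈ U, ∑ w ∈ S, |borderInc d Lc M κ u w y (Sum.inl α) (Sum.inr μ)| ≤
      ((2 * (2 * ((2 * (d + 1) * (Lc + 1) + (2 * d + 3)) * M)) + 1) ^ (d + 1) : ℕ) *
        ((2 * (2 * ((2 * (d + 1) * (Lc + 1) + (2 * d + 3)) * M)) + 1) ^ (d + 1) : ℕ) * ((M : ℝ) * (3 * (ell (d + 1) Lc : ℝ) ^ 2 / (M : ℝ) ^ (d + 1))) := by
  refine sum_abs_le_of_support (fun u w => borderInc d Lc M κ u w y (Sum.inl α) (Sum.inr μ)) y (2 * ((2 * (d + 1) * (Lc + 1) + (2 * d + 3)) * M))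
    (by positivity) (fun u w hne => ?_) (fun u w => abs_borderInc_le M hL κ u w y _ _)
  obtain ⟨hw, hy⟩ := borderInc_ne_zero M hL hne
  have hyu : l1 (u - y) ≤ (((2 * (d + 1) * (Lc + 1) + (2 * d + 3)) * M : ℕ) : ℝ) := by rw [l1_sub_symm]; exact hy
  have tri := l1_sub_triangle w u y
  have hR : (0 : ℝ) ≤ (((2 * (d + 1) * (Lc + 1) + (2 * d + 3)) * M : ℕ) : ℝ) := Nat.cast_nonneg _
  push_cast at hR hyu hw ⊢
  constructor
  · linarith
  · linarith

/-- [folklore] **COLUMN MASS, (multiplier, field) block**: at a FIXED multiplier site `x` on the first leg, summing over `u ∈ U` and the field site `w ∈ S`. -/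
theorem sum_sum_abs_borderInc_col_inr_inl_le (hL : 1 ≤ Lc) (κ : Fin (d + 1)) (x : Fin (d + 1) → ℤ) (μ α : Fin (d + 1))
    (U S : Finset (Fin (d + 1) → ℤ)) :
    ∑ u ∈ U, ∑ w ∈ S, |borderInc d Lc M κ u x w (Sum.inr μ) (Sum.inl α)| ≤
      ((2 * (2 * ((2 * (d + 1) * (Lc + 1) + (2 * d + 3)) * M)) + 1) ^ (d + 1) : ℕ) *
        ((2 * (2 * ((2 * (d + 1) * (Lc + 1) + (2 * d + 3)) * M)) + 1) ^ (d + 1) : ℕ) * ((M : ℝ) * (3 * (ell (d + 1) Lc : ℝ) ^ 2 / (M : ℝ) ^ (d + 1))) := by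
  refine sum_abs_le_of_support (fun u w => borderInc d Lc M κ u x w (Sum.inr μ) (Sum.inl α)) x (2 * ((2 * (d + 1) * (Lc + 1) + (2 * d + 3)) * M))
    (by positivity) (fun u w hne => ?_) (fun u w => abs_borderInc_le M hL κ u x w _ _)
  obtain ⟨hx, hw⟩ := borderInc_ne_zero M hL hne
  have hxu : l1 (u - x) ≤ (((2 * (d + 1) * (Lc + 1) + (2 * d + 3)) * M : ℕ) : ℝ) := by rw [l1_sub_symm]; exact hx
  have tri := l1_sub_triangle w u x
  have hR : (0 : ℝ) ≤ (((2 * (d + 1) * (Lc + 1) + (2 * d + 3)) * M : ℕ) : ℝ) := Nat.cast_nonneg _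
  push_cast at hR hxu hw ⊢
  constructor
  · linarith
  · linarith

variable (L : ℕ) [NeZero L] [NeZero Lc]

/-- [folklore] **COLUMN MASS OF THE PUSHED BORDER INCREMENT, (field, multiplier) block**: at EVERY site `y`, `Σ_u Σ_w |pushSum (M·Lc) L (borderInc d Lc M κ u) w y (inl α) (inr μ)|
≤ #LegIdx d L · [level-M column bound]` — off the new coarse lattice the column vanishes; on it, the new column is the sum of the `L^{d+1}·L` old contour columns. -/
theorem sum_sum_abs_pushSum_borderInc_col_inl_inr_le (hL : 1 ≤ Lc) (κ : Fin (d + 1)) (y : Fin (d + 1) → ℤ) (α μ : Fin (d + 1))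
    (U S : Finset (Fin (d + 1) → ℤ)) :
    ∑ u ∈ U, ∑ w ∈ S, |pushSum (M * Lc) L (borderInc d Lc M κ u) w y (Sum.inl α) (Sum.inr μ)| ≤
      ((LegIdx d L).card : ℝ) * (((2 * (2 * ((2 * (d + 1) * (Lc + 1) + (2 * d + 3)) * M)) + 1) ^ (d + 1) : ℕ) *
        ((2 * (2 * ((2 * (d + 1) * (Lc + 1) + (2 * d + 3)) * M)) + 1) ^ (d + 1) : ℕ) * ((M : ℝ) * (3 * (ell (d + 1) Lc : ℝ) ^ 2 / (M : ℝ) ^ (d + 1)))) := by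
  have hB : (0 : ℝ) ≤ ((2 * (2 * ((2 * (d + 1) * (Lc + 1) + (2 * d + 3)) * M)) + 1) ^ (d + 1) : ℕ) *
        ((2 * (2 * ((2 * (d + 1) * (Lc + 1) + (2 * d + 3)) * M)) + 1) ^ (d + 1) : ℕ) * ((M : ℝ) * (3 * (ell (d + 1) Lc : ℝ) ^ 2 / (M : ℝ) ^ (d + 1))) := by
    positivity
  by_cases hproj : Torus.proj (M * Lc * L) y = 0
  · have ey := eq_zsmul_quo_of_proj (N := M * Lc * L) hproj
    rw [ey]
    calc ∑ u ∈ U, ∑ w ∈ S, |pushSum (M * Lc) L (borderInc d Lc M κ u) w (((M * Lc * L : ℕ) : ℤ) • quo (M * Lc * L) y) (Sum.inl α) (Sum.inr μ)|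
        ≤ ∑ u ∈ U, ∑ w ∈ S, ∑ i' ∈ LegIdx d L,
            |borderInc d Lc M κ u w (((M * Lc : ℕ) : ℤ) • legPt L (Sum.inl μ : Fib d) (quo (M * Lc * L) y) i') (Sum.inl α) (Sum.inr μ)| := by
          refine Finset.sum_le_sum fun u _ => Finset.sum_le_sum fun w _ => ?_
          rw [pushSum_inl_inr_coarse_sum]
          exact Finset.abs_sum_le_sum_abs _ _
      _ = ∑ i' ∈ LegIdx d L, ∑ u ∈ U, ∑ w ∈ S,
            |borderInc d Lc M κ u w (((M * Lc : ℕ) : ℤ) • legPt L (Sum.inl μ : Fib d) (quo (M * Lc * L) y) i') (Sum.inl α) (Sum.inr μ)| := by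
          have e1 : ∀ u : Fin (d + 1) → ℤ, (∑ w ∈ S, ∑ i' ∈ LegIdx d L,
              |borderInc d Lc M κ u w (((M * Lc : ℕ) : ℤ) • legPt L (Sum.inl μ : Fib d) (quo (M * Lc * L) y) i') (Sum.inl α) (Sum.inr μ)|) =
              ∑ i' ∈ LegIdx d L, ∑ w ∈ S,
              |borderInc d Lc M κ u w (((M * Lc : ℕ) : ℤ) • legPt L (Sum.inl μ : Fib d) (quo (M * Lc * L) y) i') (Sum.inl α) (Sum.inr μ)| :=
            fun u => Finset.sum_comm
          rw [Finset.sum_congr rfl (fun u _ => e1 u), Finset.sum_comm]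
      _ ≤ ∑ _i' ∈ LegIdx d L, (((2 * (2 * ((2 * (d + 1) * (Lc + 1) + (2 * d + 3)) * M)) + 1) ^ (d + 1) : ℕ) *
            ((2 * (2 * ((2 * (d + 1) * (Lc + 1) + (2 * d + 3)) * M)) + 1) ^ (d + 1) : ℕ) * ((M : ℝ) * (3 * (ell (d + 1) Lc : ℝ) ^ 2 / (M : ℝ) ^ (d + 1)))) :=
          Finset.sum_le_sum fun i' _ => sum_sum_abs_borderInc_col_inl_inr_le M hL κ _ α μ U S
      _ = _ := by rw [Finset.sum_const, nsmul_eq_mul]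
  · have hz : ∀ u w, pushSum (M * Lc) L (borderInc d Lc M κ u) w y (Sum.inl α) (Sum.inr μ) = 0 :=
      fun u w => pushSum_inr_of_proj_ne' (M * Lc) L hproj _ w _ μ
    simp only [hz, abs_zero, Finset.sum_const_zero]
    positivity

/-- [folklore] **COLUMN MASS OF THE PUSHED BORDER INCREMENT, (multiplier, field) block** (fixed first-leg site `x`). -/
theorem sum_sum_abs_pushSum_borderInc_col_inr_inl_le (hL : 1 ≤ Lc) (κ : Fin (d + 1)) (x : Fin (d + 1) → ℤ) (μ α : Fin (d + 1))
    (U S : Finset (Fin (d + 1) → ℤ)) :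
    ∑ u ∈ U, ∑ w ∈ S, |pushSum (M * Lc) L (borderInc d Lc M κ u) x w (Sum.inr μ) (Sum.inl α)| ≤
      ((LegIdx d L).card : ℝ) * (((2 * (2 * ((2 * (d + 1) * (Lc + 1) + (2 * d + 3)) * M)) + 1) ^ (d + 1) : ℕ) *
        ((2 * (2 * ((2 * (d + 1) * (Lc + 1) + (2 * d + 3)) * M)) + 1) ^ (d + 1) : ℕ) * ((M : ℝ) * (3 * (ell (d + 1) Lc : ℝ) ^ 2 / (M : ℝ) ^ (d + 1)))) := by
  have hB : (0 : ℝ) ≤ ((2 * (2 * ((2 * (d + 1) * (Lc + 1) + (2 * d + 3)) * M)) + 1) ^ (d + 1) : ℕ) *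
        ((2 * (2 * ((2 * (d + 1) * (Lc + 1) + (2 * d + 3)) * M)) + 1) ^ (d + 1) : ℕ) * ((M : ℝ) * (3 * (ell (d + 1) Lc : ℝ) ^ 2 / (M : ℝ) ^ (d + 1))) := by
    positivity
  by_cases hproj : Torus.proj (M * Lc * L) x = 0
  · have ex := eq_zsmul_quo_of_proj (N := M * Lc * L) hproj
    rw [ex]
    calc ∑ u ∈ U, ∑ w ∈ S, |pushSum (M * Lc) L (borderInc d Lc M κ u) (((M * Lc * L : ℕ) : ℤ) • quo (M * Lc * L) x) w (Sum.inr μ) (Sum.inl α)|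
        ≤ ∑ u ∈ U, ∑ w ∈ S, ∑ i ∈ LegIdx d L,
            |borderInc d Lc M κ u (((M * Lc : ℕ) : ℤ) • legPt L (Sum.inl μ : Fib d) (quo (M * Lc * L) x) i) w (Sum.inr μ) (Sum.inl α)| := by
          refine Finset.sum_le_sum fun u _ => Finset.sum_le_sum fun w _ => ?_
          rw [pushSum_inr_inl_coarse_sum]
          exact Finset.abs_sum_le_sum_abs _ _
      _ = ∑ i ∈ LegIdx d L, ∑ u ∈ U, ∑ w ∈ S,
            |borderInc d Lc M κ u (((M * Lc : ℕ) : ℤ) • legPt L (Sum.inl μ : Fib d) (quo (M * Lc * L) x) i) w (Sum.inr μ) (Sum.inl α)| := by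
          have e1 : ∀ u : Fin (d + 1) → ℤ, (∑ w ∈ S, ∑ i ∈ LegIdx d L,
              |borderInc d Lc M κ u (((M * Lc : ℕ) : ℤ) • legPt L (Sum.inl μ : Fib d) (quo (M * Lc * L) x) i) w (Sum.inr μ) (Sum.inl α)|) =
              ∑ i ∈ LegIdx d L, ∑ w ∈ S,
              |borderInc d Lc M κ u (((M * Lc : ℕ) : ℤ) • legPt L (Sum.inl μ : Fib d) (quo (M * Lc * L) x) i) w (Sum.inr μ) (Sum.inl α)| :=
            fun u => Finset.sum_comm
          rw [Finset.sum_congr rfl (fun u _ => e1 u), Finset.sum_comm]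
      _ ≤ ∑ _i ∈ LegIdx d L, (((2 * (2 * ((2 * (d + 1) * (Lc + 1) + (2 * d + 3)) * M)) + 1) ^ (d + 1) : ℕ) *
            ((2 * (2 * ((2 * (d + 1) * (Lc + 1) + (2 * d + 3)) * M)) + 1) ^ (d + 1) : ℕ) * ((M : ℝ) * (3 * (ell (d + 1) Lc : ℝ) ^ 2 / (M : ℝ) ^ (d + 1)))) :=
          Finset.sum_le_sum fun i _ => sum_sum_abs_borderInc_col_inr_inl_le M hL κ _ μ α U S
      _ = _ := by rw [Finset.sum_const, nsmul_eq_mul]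
  · have hz : ∀ u w, pushSum (M * Lc) L (borderInc d Lc M κ u) x w (Sum.inr μ) (Sum.inl α) = 0 :=
      fun u w => pushSum_inr_of_proj_ne (M * Lc) L hproj _ w μ _
    simp only [hz, abs_zero, Finset.sum_const_zero]
    positivity

end Col

end Summit.QuantumFields.BalabanUV.Beta.GAN24.TaylorMassVHCol

end
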